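/-
Origin: expansion seat `planner-pub-hodgecm-pv12-g4-0`, handover #3 2026-08-18T06:09:08Z (`HOME/pub-hodgecm-pv12-g4/lean/Pv12g4/FockVacuumTwist.lean`, md5 e643426e, 258 lines);
landed by the gen-6 packager in gate run 24 as `HodgeCM/PerL34/FockVacuumTwist.lean` (import ^import Pv[0-9]+g[0-9]+\.→import HodgeCM.PerL34. ×1).
-/
/-
Origin: HOME/pub-hodgecm-pv12-g4/lean/Pv12g4/FockVacuumTwist.lean — session planner-pub-hodgecm-pv12-g4-0 (unit
pub-hodgecm-pv12-g4, DAG-node prover #12 gen 4, the Fock-model seat).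
Intended final place: `HodgeCM/PerL34/FockVacuumTwist.lean`.  Imports `Pv12g4.FockGroupInvariants`
(↦ `HodgeCM.PerL34.FockGroupInvariants`, handed 2026-08-18T06:03:03Z) only; asserts nothing.
-/
import Summits.HodgeConjecture.HodgeCM.PerL34.FockGroupInvariants_3

set_option autoImplicit false

/-!
# N26/N28 supplement — "𝟏 occurs in the model of one line (twisted by a power of `det`) iff the exponent is 0"
# (PerL v5 L4.1(b), proof ll. 496–499), kernel-proved at GROUP level for every integral exponent

NODE: LEMMAS.md §1 row N28 (PerL v5 `lem:arch` (b); proof ll. 496–513), the parenthetical of ll. 496–499 that the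
R3 review (erratum N3, "vacuum-character parenthetical", review ll. 1055–1060) and the adversarial readers (GAPS
adv2-O1; adv2 gen 8 X6) single out.  VERBATIM (LEMMAS.md §5 N28, tex ll. 496–499):

> (b) $b\in D_{12}$: both lines have the same sign, and each line's $\U(3)$-vacuum character is trivial
> (\cite[Lemma~3.2 and its proof]{Y1neg}: in the model of a positive line the vacuum character is
> $\det^{(m+1)/2}$ and $\mathbf 1$ occurs iff $m=-1$; for a negative line the model is the conjugate one with
> exponent $-m$, vacuum character $\det^{-(-m+1)/2}$, and $\mathbf 1$ occurs iff $m=+1$; in both admissible cases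
> the exponent is $0$), so the total twist is trivial, and the $\U(3)$-invariants of $\C[M_{3\times2}]$ (or of
> its conjugate) are the constants

WHAT THIS FILE KERNEL-PROVES (complete proofs, standard axiom trio; namespace `HodgeCM.PerL34.Fock.GroupLevel`).
In the polynomial model `LineModel = ℂ[z₁,z₂,z₃]` of ONE line for the pair `(U(3), U(1))`, with `A ∈ U(3) =
Matrix.unitaryGroup (Fin 3) ℂ` acting by the linear substitution `z_a ↦ Σ_b A_{ab} z_b` (`lineSubst A`) and the
whole model twisted by the character `det^k`, `k : ℤ`:
* `isDetTwistedFixed_iff k f : (∀ A ∈ U(3), det(A)^k • A·f = f) ↔ f = 0 ∨ (k = 0 ∧ ∃ x, f = C x)`;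
* `trivialType_occurs_iff k : (∃ f ≠ 0, ∀ A ∈ U(3), det(A)^k • A·f = f) ↔ k = 0` — "𝟏 occurs iff [the
  exponent of det is] 0", positive line;
* `trivialType_occurs_conj_iff k` — the same for the CONJUGATE model (`A` acting through `Ā`; negative line,
  l. 498), via `isDetTwistedFixedConj_iff_neg` (`det Ā = (det A)⁻¹` on `U(3)`: twist `k` ↦ `-k`).
So, granted the dictionary's value of the exponent (below), PerL's two "iff" clauses and "in both admissible cases
the exponent is 0, so the total twist is trivial" are kernel statements about the polynomial model; the conclusion
"the U(3)-invariants of ℂ[M_{3×2}] (or of its conjugate) are the constants" is `isU3FixedGrp_iff` /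
`isU3FixedGrp_iff_conj` of `FockGroupInvariants`.

METHOD (finitely many group elements): the torus elements `diag(ζ,1,1), diag(1,ζ,1), diag(1,1,ζ)`, `ζ = e^{2πi/N}`,
`N > m_a + |k|`, act on `z^m ⊗ det^k` by `ζ^{m_a + k}`, forcing `m = (c,c,c)` with `c = -k`
(`IsDetTwistedFixed.exponent`, via `eq_zero_of_ζ_zpow_eq_one`); so `f = r·(z₁z₂z₃)^c`; the rational rotation
`R01 ∈ SO(3)` (`det R01 = 1`, `FockGroupInvariants`) and the point evaluation `z = (1,0,1) ↦ (3/5, 4/5, 1)` give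
`r·(12/25)^c = r·0^c`, i.e. `c = 0` unless `f = 0` (`IsDetTwistedFixed.eq_zero_or`).

WHAT STAYS DICTIONARY / PRINT (node N26; unchanged, NOT restated or used here): (i) that `(𝓕_{i,b}, ω)` restricted
to `U(V_b) × U(W_{i,b}) = U(3) × U(1)` IS this polynomial model with `U(3)`-vacuum character `det^{(m+1)/2}` on the
`U(1)`-exponent-`m` piece (resp. the conjugate model, `det^{-(-m+1)/2}`) — the K-type structure of the Fock model of
a compact dual pair [J. Adams, The theta correspondence over ℝ (2007), Prop. 6.6; Borel–Wallach (2000) VIII 2.4–2.5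
— locators in `ArchB`'s docstring; the verified print replacement of [Y1neg] L3.2 named by adv2-O1]; (ii) the
half-integral exponents `(m+1)/2 ∉ ℤ` (genuine characters of the double cover `Ũ(3)`), for which "𝟏 occurs" is
false for the cover-theoretic reason that `𝟏` is not genuine — outside any polynomial model and not needed in the
admissible cases `m = ∓1` (exponent `0 ∈ ℤ`).  adv2 gen 8 X6 notes that the FORMULAS of ll. 497–499 are not
load-bearing for L4.1(b)/(c) (only "the total twist is trivial" is); this file shows that, at the polynomial
level, even the two "iff" clauses hold as stated, for every integral exponent.

LABEL CENSUS: KERNEL — every declaration; PRINT — none; INPUT — none; ASSERTED — nothing (no PerL / [Y1neg] /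
QW8 / 2001-programme statement is used).  `#print axioms` of `isDetTwistedFixed_iff`, `trivialType_occurs_iff`,
`trivialType_occurs_conj_iff`, `IsDetTwistedFixed.eq_zero_or`, `isDetTwistedFixedConj_iff_neg`
= `[propext, Classical.choice, Quot.sound]` (scratch `Pv12g4/AxCheck.lean`).

PACKAGER: ONE NEW FILE, additive; its only import `Pv12g4.FockGroupInvariants` ↦ `HodgeCM.PerL34.FockGroupInvariants`
(pv12-g4 HANDOVER #2, same run); intended path `HodgeCM/PerL34/FockVacuumTwist.lean`.
-/

namespace HodgeCM.PerL34.Fock.GroupLevel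

open MvPolynomial Finsupp

open scoped BigOperators ComplexConjugate

section Line

/-- The polynomial Fock model of ONE positive line `W_{i,b}` for the pair `(U(V_b), U(W_{i,b})) = (U(3), U(1))`:
`ℂ[z₁,z₂,z₃]` (PerL l. 497: "in the model of a positive line …"). -/
abbrev LineModel : Type := MvPolynomial (Fin 3) ℂ

/-- `A · z_a = Σ_b A_{ab} z_b`. -/
noncomputable def lineSubst (A : Matrix (Fin 3) (Fin 3) ℂ) : LineModel →ₐ[ℂ] LineModel :=
  aeval fun a => ∑ b : Fin 3, A a b • (X b : LineModel)

/-- (Ported verbatim from the HodgeCMPerL package; no docstring in the source.) -/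
theorem lineSubst_X (A : Matrix (Fin 3) (Fin 3) ℂ) (a : Fin 3) :
    lineSubst A (X a) = ∑ b : Fin 3, A a b • (X b : LineModel) := by
  rw [lineSubst, aeval_X]

/-- **The trivial `U(3)`-type in `ℂ[z₁,z₂,z₃] ⊗ det^k`**: `f` is a `U(3)`-fixed vector of the polynomial model
twisted by the character `det^k` (`k : ℤ`), i.e. `det(A)^k · (A · f) = f` for every unitary `A`. -/
def IsDetTwistedFixed (k : ℤ) (f : LineModel) : Prop :=
  ∀ A ∈ Matrix.unitaryGroup (Fin 3) ℂ, (A.det ^ k) • lineSubst A f = f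

/-- (Ported verbatim from the HodgeCMPerL package; no docstring in the source.) -/
theorem lineSubst_diagonal (d : Fin 3 → ℂ) : lineSubst (Matrix.diagonal d) = scale d := by
  refine MvPolynomial.algHom_ext fun a => ?_
  rw [scale_X, lineSubst_X]
  simp [Matrix.diagonal_apply, smul_eq_C_mul]

/-- The torus element of `U(3)` with `x` in position `a` and `1` elsewhere. -/
noncomputable def torL (a : Fin 3) (x : ℂ) : Fin 3 → ℂ := fun b => if b = a then x else 1

/-- (Ported verbatim from the HodgeCMPerL package; no docstring in the source.) -/
theorem det_torL (a : Fin 3) (x : ℂ) : (Matrix.diagonal (torL a x)).det = x := by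
  rw [Matrix.det_diagonal]
  fin_cases a <;> simp [torL, Fin.prod_univ_three]

/-- (Ported verbatim from the HodgeCMPerL package; no docstring in the source.) -/
theorem torL_mem (a : Fin 3) {x : ℂ} (hx : x * conj x = 1) :
    Matrix.diagonal (torL a x) ∈ Matrix.unitaryGroup (Fin 3) ℂ :=
  diagonal_mem_unitaryGroup _ fun i => by
    unfold torL
    split_ifs
    · exact hx
    · simp

/-- (Ported verbatim from the HodgeCMPerL package; no docstring in the source.) -/
theorem coeff_lineSubst_torL (a : Fin 3) (x : ℂ) (f : LineModel) (m : Fin 3 →₀ ℕ) :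
    coeff m (lineSubst (Matrix.diagonal (torL a x)) f) = coeff m f * x ^ (m a) := by
  rw [lineSubst_diagonal, coeff_scale, scaleFactor_eq_prod]
  congr 1
  fin_cases a <;> simp [torL]

/-- Torus step: every monomial `z^m` of a `det^k`-twisted fixed vector has `m_a = -k` for each `a`
(the torus `diag(ζ,1,1)` etc., `ζ = e^{2πi/N}` with `N` large, acts on `z^m ⊗ det^k` by `ζ^{m_a + k}`). -/
theorem IsDetTwistedFixed.exponent {k : ℤ} {f : LineModel} (h : IsDetTwistedFixed k f)
    {m : Fin 3 →₀ ℕ} (hm : m ∈ f.support) (a : Fin 3) : ((m a : ℕ) : ℤ) + k = 0 := by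
  classical
  have hc : coeff m f ≠ 0 := MvPolynomial.mem_support_iff.mp hm
  have hN : m a + k.natAbs + 1 ≠ 0 := by omega
  have h1 := congrArg (coeff m) (h _ (torL_mem a (ζ_mul_conj (m a + k.natAbs + 1) hN)))
  rw [coeff_smul, coeff_lineSubst_torL, det_torL, smul_eq_mul] at h1
  have h2 : ζ (m a + k.natAbs + 1) ^ (((m a : ℕ) : ℤ) + k) = 1 := by
    rw [zpow_add₀ (ζ_ne_zero _ hN), zpow_natCast]
    have : coeff m f * (ζ (m a + k.natAbs + 1) ^ (m a) * ζ (m a + k.natAbs + 1) ^ k) = coeff m f * 1 := by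
      rw [mul_one]; linear_combination h1
    exact mul_left_cancel₀ hc this
  exact eq_zero_of_ζ_zpow_eq_one (by omega) h2

/-- (Ported verbatim from the HodgeCMPerL package; no docstring in the source.) -/
theorem det_R01 : R01.det = 1 := by
  simp [R01, Matrix.det_fin_three]; norm_num

/-- Point evaluation commutes with the substitution: `(A·f)(x) = f(A x)`. -/
theorem aeval_lineSubst (A : Matrix (Fin 3) (Fin 3) ℂ) (x : Fin 3 → ℂ) (f : LineModel) :
    aeval x (lineSubst A f) = aeval (fun a => ∑ b, A a b * x b) f := by
  rw [lineSubst, aeval_eq_bind₁ (fun a => ∑ b : Fin 3, A a b • (X b : LineModel)), aeval_bind₁]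
  refine congrArg (fun g : Fin 3 → ℂ => aeval g f) (funext fun a => ?_)
  simp [smul_eq_mul]

/-- PerL ll. 497–499 at group level, integral exponents: a NON-ZERO `U(3)`-fixed vector of `ℂ[z₁,z₂,z₃] ⊗ det^k`
exists only for `k = 0`, and then it is a constant ("𝟏 occurs iff [the exponent of det is 0] … so the total twist
is trivial, and the U(3)-invariants … are the constants").  Proof: the torus forces every monomial to be
`(z₁z₂z₃)^c`, `c = -k`; the rotation `R01 ∈ SO(3)` (det `1`) evaluated at `z = (1,0,1) ↦ (3/5,4/5,1)` gives
`coeff · (12/25)^c = 0` unless `c = 0`. -/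
theorem IsDetTwistedFixed.eq_zero_or {k : ℤ} {f : LineModel} (h : IsDetTwistedFixed k f) :
    f = 0 ∨ (k = 0 ∧ f = C (coeff 0 f)) := by
  classical
  by_cases hf : f = 0
  · exact Or.inl hf
  right
  have hne : f.support.Nonempty :=
    Finset.nonempty_iff_ne_empty.mpr (mt MvPolynomial.support_eq_empty.mp hf)
  obtain ⟨m₀, hm₀⟩ := hne
  have hall : ∀ m ∈ f.support, m = m₀ := by
    intro m hm
    ext a
    have e1 := h.exponent hm a
    have e2 := h.exponent hm₀ a
    omega
  have hc_eq : ∀ a, m₀ a = m₀ 0 := by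
    intro a
    have e1 := h.exponent hm₀ a
    have e2 := h.exponent hm₀ 0
    omega
  have hk : k = -((m₀ 0 : ℕ) : ℤ) := by have := h.exponent hm₀ 0; omega
  -- `f` is the single monomial `m₀`
  have hr : coeff m₀ f ≠ 0 := MvPolynomial.mem_support_iff.mp hm₀
  have hf_eq : f = monomial m₀ (coeff m₀ f) := by
    conv_lhs => rw [f.as_sum]
    exact Finset.sum_eq_single_of_mem m₀ hm₀ (fun m hm hne => absurd (hall m hm) hne)
  -- the exponent `c = m₀ 0` vanishes
  have hc0 : m₀ 0 = 0 := by
    by_contra hc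
    have hR : lineSubst R01 f = f := by
      have := h R01 R01_mem
      rwa [det_R01, one_zpow, one_smul] at this
    have hev := congrArg (aeval (![1, 0, 1] : Fin 3 → ℂ)) hR
    have ept : (fun a => ∑ b, R01 a b * (![1, 0, 1] : Fin 3 → ℂ) b) = ![3 / 5, 4 / 5, 1] := by
      funext a; fin_cases a <;> simp [R01, Fin.sum_univ_three]
    rw [aeval_lineSubst, ept, hf_eq, aeval_monomial, aeval_monomial,
      Finsupp.prod_fintype _ _ (fun i => pow_zero _), Finsupp.prod_fintype _ _ (fun i => pow_zero _),
      Fin.prod_univ_three, Fin.prod_univ_three, hc_eq 1, hc_eq 2] at hev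
    simp [zero_pow hc, hr] at hev
  refine ⟨by rw [hk, hc0]; simp, ?_⟩
  have hm0 : m₀ = 0 := by ext a; rw [hc_eq a, hc0]; rfl
  rw [hm0] at hf_eq
  rw [hf_eq, coeff_monomial, if_pos rfl]
  rfl

/-- (Ported verbatim from the HodgeCMPerL package; no docstring in the source.) -/
theorem isDetTwistedFixed_zero_C (x : ℂ) : IsDetTwistedFixed 0 (C x) := by
  intro A _
  rw [zpow_zero, one_smul, MvPolynomial.algHom_C, MvPolynomial.algebraMap_eq]

/-- **Characterisation.** -/
theorem isDetTwistedFixed_iff (k : ℤ) (f : LineModel) :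
    IsDetTwistedFixed k f ↔ f = 0 ∨ (k = 0 ∧ ∃ x : ℂ, f = C x) := by
  constructor
  · intro h
    rcases h.eq_zero_or with h0 | ⟨hk, hC⟩
    · exact Or.inl h0
    · exact Or.inr ⟨hk, _, hC⟩
  · rintro (rfl | ⟨rfl, x, rfl⟩)
    · intro A _; rw [map_zero, smul_zero]
    · exact isDetTwistedFixed_zero_C x

/-- PerL ll. 497–499 ("𝟏 occurs iff …"): the trivial `U(3)`-type occurs in `ℂ[z₁,z₂,z₃] ⊗ det^k` iff `k = 0`. -/
theorem trivialType_occurs_iff (k : ℤ) : (∃ f : LineModel, f ≠ 0 ∧ IsDetTwistedFixed k f) ↔ k = 0 := by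
  constructor
  · rintro ⟨f, hf, h⟩
    rcases h.eq_zero_or with h0 | ⟨hk, _⟩
    · exact absurd h0 hf
    · exact hk
  · rintro rfl
    exact ⟨C 1, by simp, isDetTwistedFixed_zero_C 1⟩

/-! ### The conjugate model (a negative line; PerL ll. 500–501 "the conjugate model with vacuum
`det^{(m-1)/2} ⊗ (duals)`, and 𝟏 occurs iff m = +1"): `A` acts through `Ā` -/

/-- `U(3)`-fixed vector of the CONJUGATE polynomial model twisted by `det^k`: `det(A)^k · (Ā · f) = f`. -/
def IsDetTwistedFixedConj (k : ℤ) (f : LineModel) : Prop :=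
  ∀ A ∈ Matrix.unitaryGroup (Fin 3) ℂ, (A.det ^ k) • lineSubst (A.map (starRingEnd ℂ)) f = f

/-- (Ported verbatim from the HodgeCMPerL package; no docstring in the source.) -/
theorem det_map_conj (A : Matrix (Fin 3) (Fin 3) ℂ) : (A.map (starRingEnd ℂ)).det = conj A.det := by
  rw [RingHom.map_det, RingHom.mapMatrix_apply]

/-- (Ported verbatim from the HodgeCMPerL package; no docstring in the source.) -/
theorem det_mul_conj_det_of_mem {A : Matrix (Fin 3) (Fin 3) ℂ} (hA : A ∈ Matrix.unitaryGroup (Fin 3) ℂ) :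
    A.det * conj A.det = 1 := by
  rw [Matrix.mem_unitaryGroup_iff] at hA
  have := congrArg Matrix.det hA
  rwa [Matrix.det_mul, Matrix.star_eq_conjTranspose, Matrix.det_conjTranspose, Matrix.det_one] at this

/-- On `U(3)`, `det(Ā) = det(A)⁻¹`, so the conjugate model with twist `det^k` is the model with twist `det^{-k}`. -/
theorem isDetTwistedFixedConj_iff_neg (k : ℤ) (f : LineModel) :
    IsDetTwistedFixedConj k f ↔ IsDetTwistedFixed (-k) f := by
  have key : ∀ {A : Matrix (Fin 3) (Fin 3) ℂ}, A ∈ Matrix.unitaryGroup (Fin 3) ℂ →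
      (A.map (starRingEnd ℂ)).det = A.det⁻¹ := fun hA => by
    rw [det_map_conj]; exact eq_inv_of_mul_eq_one_right (det_mul_conj_det_of_mem hA)
  have e : ∀ A : Matrix (Fin 3) (Fin 3) ℂ, (A.map (starRingEnd ℂ)).map (starRingEnd ℂ) = A := fun A => by
    ext i j; simp
  constructor
  · intro h A hA
    have h1 := h _ (map_conj_mem_unitaryGroup hA)
    rwa [e, key hA, inv_zpow'] at h1
  · intro h A hA
    have h1 := h _ (map_conj_mem_unitaryGroup hA)
    rwa [key hA, inv_zpow', neg_neg] at h1

/-- The conjugate line: the trivial `U(3)`-type occurs in `conj(ℂ[z₁,z₂,z₃]) ⊗ det^k` iff `k = 0`. -/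
theorem trivialType_occurs_conj_iff (k : ℤ) :
    (∃ f : LineModel, f ≠ 0 ∧ IsDetTwistedFixedConj k f) ↔ k = 0 := by
  simp only [isDetTwistedFixedConj_iff_neg, trivialType_occurs_iff, neg_eq_zero]

end Line

end HodgeCM.PerL34.Fock.GroupLevel
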